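import Literature.IUT.LogThetaLattice.PerpPrimeStrips
import Literature.IUT.HodgeArakelov.KummerPrimeStrips
import HarnessLib

/-!
# [IUTchIII] Definition 2.4 (i) at BAD places: `O^▶ := O^⊥/(torsion)` IS [IUTchII] Def 4.9 (ii)'s `O^▶ = O^⊥/μ_{2l} ≅ O^▷/O^×` (junction, proof-only)

Mochizuki, *Inter-universal Teichmüller Theory III*, kurims manuscript (May 2020), Definition 2.4 (i), p. 88 l. 2–6: «at
each `w ∈ V̲^{bad}`, the splittings of the split Frobenioid `‡F^⊢_w` determine submonoids "`O^⊥(−) ⊆ O^▷(−)`", as well as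
quotient monoids "`O^⊥(−) ↠ O^▶(−)`" [i.e., by forming the quotient of "`O^⊥(−)`" by its torsion subgroup]» — recalling
*Inter-universal Teichmüller Theory II*, Definition 4.9 (ii), p. 155: «`O^⊥(‡A) ⊆ O^▷(‡A)` the submonoid generated by
`μ_{2l}(‡A)` and the image of the splittings …, `O^▶(‡A) := O^⊥(‡A)/μ_{2l}(‡A)` … [so we have a natural isomorphism
`O^▷(‡A)/O^×(‡A) ⥲ O^▶(‡A)`]» (claim key `Mochizuki2012`, D-0012, status disputed; definitional content only).

PROOF-ONLY junction (0 defs; abc-iut cell, seat abc-iut-L6-t8 gen 6, for the NODES per-node clause coverage of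
IUTchIII:Def2.4(i), clause (i-b) «bad places»). Typed vocabulary, BY NAME, nothing restated:
* abc-iut-L6-t3 (`PerpPrimeStrips.lean` p405292, `StripCategories.lean` p404180): `PerpMonoidData` = (`O`, `perp`),
  `PerpMonoidData.tri := ModTorsion ↥perp`, `PerpMonoidData.toTri := ModTorsion.mk`, where `ModTorsion M` is the quotient of
  a commutative monoid by «`y = ζ·x` for a torsion unit `ζ` of `M`» ([IUTchIII] Def 2.4 (i) reading);
* abc-iut-L6-t2 (`KummerPrimeStrips.lean` p411787…): `OPerp O twoL S` (= `μ_{twoL}·S`), `OTri O := Associates O` (= `O^▷/O^×`),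
  `toOTri`, the split-Frobenioid presentation `OPerpPresentsAssociates O twoL S`, and the Def 4.9 (ii)–(iv) local datum
  `NonarchTriMuDatum l k G X` whose FIELD `presents` carries that presentation with `twoL = torsionOrder l k` (`2l` at bad,
  `1` at good nonarchimedean places).

Proved here. (1) `isOfFinOrder_units_OPerp`: under the presentation, EVERY unit of the monoid `O^⊥` is torsion (indeed a
`twoL`-th root of unity of `O^▷`) — so «the torsion subgroup of `O^⊥`» of III Def 2.4 (i) is the whole unit group of `O^⊥`
and is `μ_{2l}`, as II Def 4.9 (ii) has it. (2) `exists_modTorsion_OPerp_mulEquiv_associates`: the quotient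
`O^⊥/(torsion)` (L6-t3's `ModTorsion`) is canonically `≃*` to `O^▷/O^×` (L6-t2's `Associates`), compatibly with the two
quotient maps — the printed «natural isomorphism `O^▷(‡A)/O^×(‡A) ⥲ O^▶(‡A)`». (3) `PerpMonoidData.exists_tri_mulEquiv_OTri`:
hence the `PerpMonoidData` term `⟨D.O, D.perp⟩` built from ANY L6-t2 datum `D : NonarchTriMuDatum l k G X` (any place
type, `0 < l`) has III Def 2.4 (i)'s `O^▶` identified with II Def 4.9 (ii)'s `O^▶` along the quotient maps — the bad-place
clause of Def 2.4 (i) composed IN THE KERNEL with «the splittings of the split Frobenioid» of Def 4.9 (ii).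
Honest scope: the ARCHIMEDEAN clause of Def 2.4 (i)/(ii) (an object of `TM^⊢`) is not touched here; nothing is asserted
about [IUTchIII] Cor. 3.12; typed ≠ proved. [claim: Mochizuki2012, status: disputed]
-/

namespace Literature.IUT.LogThetaLattice

open Literature.IUT.HodgeArakelov

universe u

section Abstract

variable {O : Type u} [CommMonoid O] {twoL : ℕ} {S : Submonoid O}

/-- A `twoL`-th root of unity of `O^▷`, read inside `O^⊥ = μ_{twoL}·S` together with its inverse, is a UNIT OF THE
MONOID `O^⊥` ([IUTchII] Def 4.9 (ii) p.155 «the submonoid generated by `μ_{2l}(‡A)` and …»).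
[cite: Mochizuki2012, II Def 4.9 (ii) p.155] [claim: Mochizuki2012, status: disputed] -/
theorem exists_unit_OPerp_of_rootsOfUnity (ζ : Oˣ) (hζ : ζ ∈ rootsOfUnity twoL O) :
    ∃ u : (↥(OPerp O twoL S))ˣ, ((u : ↥(OPerp O twoL S)) : O) = (ζ : O) ∧
      ((u⁻¹ : (↥(OPerp O twoL S))ˣ) : ↥(OPerp O twoL S)) = ⟨(ζ⁻¹ : Oˣ), rootsOfUnity_mem_OPerp O twoL S _ (inv_mem hζ)⟩ := by
  refine ⟨⟨⟨(ζ : O), rootsOfUnity_mem_OPerp O twoL S ζ hζ⟩,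
    ⟨((ζ⁻¹ : Oˣ) : O), rootsOfUnity_mem_OPerp O twoL S _ (inv_mem hζ)⟩, ?_, ?_⟩, rfl, rfl⟩
  · exact Subtype.ext (by simp)
  · exact Subtype.ext (by simp)

/-- **IUTchIII:Def2.4(i)** / **IUTchII:Def4.9(ii)** (III p.88 l.5–6 «the quotient of `O^⊥(−)` by its torsion subgroup»;
II p.155 «`O^▶(‡A) := O^⊥(‡A)/μ_{2l}(‡A)`»): under the split-Frobenioid presentation, EVERY unit of the monoid `O^⊥`
is a `twoL`-th root of unity of `O^▷`, hence TORSION — the torsion subgroup of `O^⊥` is its whole unit group `= μ_{2l}`.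
[cite: Mochizuki2012, III Def 2.4 (i) p.88] [claim: Mochizuki2012, status: disputed] -/
theorem isOfFinOrder_units_OPerp (hk : 0 < twoL) (h : OPerpPresentsAssociates O twoL S)
    (u : (↥(OPerp O twoL S))ˣ) :
    (∃ ζ : Oˣ, ζ ∈ rootsOfUnity twoL O ∧ ((u : ↥(OPerp O twoL S)) : O) = ζ) ∧ IsOfFinOrder u := by
  -- the image of `u` in `O^▷/O^×` is `1`: `(u : O)` is a unit of `O^▷`
  have hu1 : toOTri O ((u : ↥(OPerp O twoL S)) : O) = toOTri O 1 := by
    have hunit : IsUnit ((u : ↥(OPerp O twoL S)) : O) := by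
      refine IsUnit.of_mul_eq_one (((u⁻¹ : (↥(OPerp O twoL S))ˣ) : ↥(OPerp O twoL S)) : O) ?_
      have h1 := congrArg Subtype.val u.mul_inv
      rwa [MulMemClass.coe_mul, OneMemClass.coe_one] at h1
    simp [toOTri, Associates.mkMonoidHom_apply, Associates.mk_eq_one, hunit]
  obtain ⟨ζ, hζ, hx⟩ := (h.2 _ (u : ↥(OPerp O twoL S)).2 1 (one_mem _)).mp hu1
  rw [mul_one] at hx
  refine ⟨⟨ζ, hζ, hx⟩, ?_⟩
  -- `u ^ twoL = 1` in `O^⊥`, since `ζ ^ twoL = 1`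
  rw [isOfFinOrder_iff_pow_eq_one]
  refine ⟨twoL, hk, Units.ext (Subtype.ext ?_)⟩
  have hz : ((ζ : O)) ^ twoL = 1 := by
    have := congrArg (fun z : Oˣ => (z : O)) ((mem_rootsOfUnity twoL ζ).mp hζ)
    simpa using this
  rw [Units.val_pow_eq_pow_val, SubmonoidClass.coe_pow, hx, hz, Units.val_one, OneMemClass.coe_one]

/-- **IUTchIII:Def2.4(i)** = **IUTchII:Def4.9(ii)** at a nonarchimedean place (III p.88 l.2–6; II p.155 «[so we have a natural
isomorphism `O^▷(‡A)/O^×(‡A) ⥲ O^▶(‡A)`]»): under the split-Frobenioid presentation `OPerpPresentsAssociates O twoL S`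
(`0 < twoL`), abc-iut-L6-t3's quotient `O^⊥/(torsion)` = `ModTorsion ↥(OPerp O twoL S)` is CANONICALLY `≃*` to
abc-iut-L6-t2's `O^▷/O^× = Associates O`, compatibly with the two quotient maps out of `O^⊥`.
[cite: Mochizuki2012, III Def 2.4 (i) p.88] [claim: Mochizuki2012, status: disputed] -/
theorem exists_modTorsion_OPerp_mulEquiv_associates (hk : 0 < twoL) (h : OPerpPresentsAssociates O twoL S) :
    ∃ e : ModTorsion ↥(OPerp O twoL S) ≃* Associates O,
      ∀ x : ↥(OPerp O twoL S), e (ModTorsion.mk _ x) = Associates.mk (x : O) := by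
  classical
  set P := OPerp O twoL S with hP
  -- the composite `O^⊥ ↪ O^▷ ↠ O^▷/O^×`
  let f : ↥P →* Associates O := (Associates.mkMonoidHom).comp P.subtype
  have hf : ∀ x : ↥P, f x = Associates.mk (x : O) := fun x => rfl
  -- it kills the torsion congruence of `O^⊥` (indeed every unit of `O^⊥` is a unit of `O^▷`)
  have hker : torsionCon ↥P ≤ Con.ker f := by
    intro x y hxy
    obtain ⟨u, -, rfl⟩ := hxy
    have hunit : IsUnit ((u : ↥P) : O) := by
      refine IsUnit.of_mul_eq_one (((u⁻¹ : (↥P)ˣ) : ↥P) : O) ?_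
      have h1 := congrArg Subtype.val u.mul_inv
      rwa [MulMemClass.coe_mul, OneMemClass.coe_one] at h1
    show f x = f ((u : ↥P) * x)
    rw [map_mul, hf (u : ↥P), Associates.mk_eq_one.mpr hunit, one_mul]
  let g : ModTorsion ↥P →* Associates O := Con.lift _ f hker
  have hg : ∀ x : ↥P, g (ModTorsion.mk _ x) = Associates.mk (x : O) := fun x => rfl
  have hsurj : Function.Surjective g := by
    intro a
    obtain ⟨x, hx, hxa⟩ := h.1 a
    exact ⟨ModTorsion.mk _ ⟨x, hx⟩, by rw [hg]; exact hxa⟩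
  have hinj : Function.Injective g := by
    intro a b hab
    obtain ⟨x, rfl⟩ := ModTorsion.mk_surjective (↥P) a
    obtain ⟨y, rfl⟩ := ModTorsion.mk_surjective (↥P) b
    rw [hg, hg] at hab
    -- `Associates.mk x = Associates.mk y` ⇒ `x = ζ·y` with `ζ ∈ μ_{twoL}` (the presentation) ⇒ `y = ζ⁻¹·x`, a torsion unit of `O^⊥`
    obtain ⟨ζ, hζ, hxy⟩ := (h.2 _ x.2 _ y.2).mp hab
    rw [ModTorsion.mk_eq_mk_iff]
    obtain ⟨uinv, huinv, -⟩ := exists_unit_OPerp_of_rootsOfUnity (S := S) (ζ⁻¹) (inv_mem hζ)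
    refine ⟨uinv, ?_, Subtype.ext ?_⟩
    · exact (isOfFinOrder_units_OPerp hk h uinv).2
    · show (y : O) = ((uinv : ↥P) : O) * (x : O)
      rw [huinv, hxy, ← mul_assoc, Units.inv_mul, one_mul]
  exact ⟨MulEquiv.ofBijective g ⟨hinj, hsurj⟩, fun x => hg x⟩

end Abstract

/-- **IUTchIII:Def2.4(i)** over the [IUTchII] Def 4.9 (ii)–(iv) LOCAL DATUM (kurims III p.88 l.2–14; II pp.155–156): for ANY
`D : NonarchTriMuDatum l k G X` of abc-iut-L6-t2 (bad or good nonarchimedean type `k`; `0 < l`), the III-Def-2.4-(i) monoid datum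
`⟨O^▷(‡A), O^⊥(‡A)⟩ : PerpMonoidData` (abc-iut-L6-t3) formed from «the splittings of the split Frobenioid» has its quotient
`O^▶ := O^⊥/(torsion)` (`PerpMonoidData.tri`, map `toTri`) CANONICALLY `≃*` to Def 4.9 (ii)'s `O^▶ = O^▷/O^×` (`OTri`, map
`toOTri`), compatibly with the quotient maps. At good places this is print's «we set `O^▶(−) := O^⊥(−)`» read through
`torsionOrder l goodNonarch = 1`. [cite: Mochizuki2012, III Def 2.4 (i) p.88] [claim: Mochizuki2012, status: disputed] -/
theorem PerpMonoidData.exists_tri_mulEquiv_OTri {l : ℕ} (hl : 0 < l) {k : PlaceKind} {G : Type u} [Group G]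
    {X : GroupTheoreticUnits.{u, u} G} (D : NonarchTriMuDatum.{u, u, u} l k G X) :
    ∃ e : (⟨D.O, D.perp⟩ : PerpMonoidData.{u}).tri ≃* OTri D.O,
      ∀ x : ↥D.perp, e ((⟨D.O, D.perp⟩ : PerpMonoidData.{u}).toTri x) = toOTri D.O (x : D.O) := by
  have hk : 0 < torsionOrder l k := by
    cases k
    · show 0 < 2 * l; omega
    · exact Nat.one_pos
    · exact Nat.one_pos
  obtain ⟨e, he⟩ := exists_modTorsion_OPerp_mulEquiv_associates (S := D.splitting) hk D.presents
  exact ⟨e, fun x => he x⟩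

end Literature.IUT.LogThetaLattice
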